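import Literature.AlgebraicGeometry.Resolution.StrictTransformAwayFromCentre
import Literature.AlgebraicGeometry.Resolution.StrictTransformFiniteFlatteningFinal
import Literature.RingTheory.Localization.FiniteHull
import Mathlib.AlgebraicGeometry.Morphisms.Finite
import Mathlib.AlgebraicGeometry.Morphisms.FinitePresentation
import HarnessLib

/-!
# Raynaud–Gruson flattening (Stacks 081R) for finite morphisms

Topic: `Literature/AlgebraicGeometry/Resolution`. The named fact `Stacks081R`
(`StrictTransformFlattening.lean`; Raynaud–Gruson 1971, Première partie, Thm. 5.2.2 = Stacks,
Tag 081R) for a FINITE morphism `f : X → S` (`S` quasi-compact and quasi-separated, `U ⊆ S`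
quasi-compact open, `X_U → U` flat and locally of finite presentation): there is a `U`-admissible
blowing up of `S` along which the strict transform of `X` is flat and locally of finite
presentation. `StrictTransformFiniteFlatteningFinal.lean` proves this when `f` is moreover
locally of finite presentation on all of `S`; this file removes that hypothesis by the reduction
of Stacks, Tag 0810 (proof, ¶1): locally on `S` (`exists_isBlowup_flat_lfp_of_forall_affineOpens_base`),
`X = Spec B` embeds as a closed subscheme of `X' = Spec B'` with `B'` finite AND finitely
presented over `R = Γ(S, 𝒪_S)` and `X → X'` an isomorphism over `U`
(`Literature.RingTheory.Localization.exists_finite_finitePresentation_surjective`); a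
`U`-admissible blowing up with centre supported on exactly `S ∖ U` flattening the strict
transform of `X'` (`exists_isBlowup_support_eq_flat_lfp_of_isFinite`) flattens that of `X`, the
two strict transforms being isomorphic (`blowupStrictTransformMap_comp_iff_of_isClosedImmersion`,
`StrictTransformAwayFromCentre.lean`).

* `appLE_of_morphismRestrict` — ring-level `Q` over affine opens of `U` from `P (f ∣_ U)`;
* `isIso_morphismRestrict_basicOpen_of_ker_torsion` — a closed immersion of affine schemes whose
  kernel is `b`-power torsion is an isomorphism over `D(b)`;
* `exists_isBlowup_flat_lfp_of_isFinite_of_isAffine` — the affine-base case;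
* `exists_isBlowup_flat_lfp_of_isFinite` — **`Stacks081R` for finite `f`.**

## References

* The Stacks Project, Tag 081R (More on Flatness, Lemma 38.31.1), Tag 0810 (proof, ¶1),
  Tag 080D. [StacksProject]
* M. Raynaud, L. Gruson, *Critères de platitude et de projectivité. Techniques de
  «platification» d'un module*, Invent. Math. 13 (1971) 1–89, Première partie, Thm. 5.2.2.
  [RaynaudGruson1971]
-/

noncomputable section

open CategoryTheory CategoryTheory.Limits AlgebraicGeometry TopologicalSpace

namespace Literature.AlgebraicGeometry.Resolution

universe u

open Literature.AlgebraicGeometry.Limits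

/-! ## Helpers -/

section Helpers

/-- **Ring-level `Q` over affine opens of `U` from `P (f|_U)`**, for `P` a property of morphisms
with `HasRingHomProperty P Q`: if `f|_U` has `P` then `Γ(S, V) → Γ(X, W)` has `Q` for affine opens
`V ⊆ U` of `S` and `W ⊆ f⁻¹V` of `X`. [folklore] -/
theorem appLE_of_morphismRestrict (P : MorphismProperty Scheme.{u})
    {Q : ∀ {R S : Type u} [CommRing R] [CommRing S], (R →+* S) → Prop} [HasRingHomProperty P Q]
    {X S : Scheme.{u}} (f : X ⟶ S) (U : S.Opens) (hP : P (f ∣_ U)) (V : S.affineOpens)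
    (hV : (V : S.Opens) ≤ U) (W : X.affineOpens) (hW : (W : X.Opens) ≤ f ⁻¹ᵁ (V : S.Opens)) :
    Q (f.appLE V W hW).hom := by
  let V' : (U : Scheme.{u}).affineOpens := Limits.preimageAffineOpens U V hV
  let W' : ((f ⁻¹ᵁ U : X.Opens) : Scheme.{u}).affineOpens :=
    Limits.preimageAffineOpens (f ⁻¹ᵁ U) W (hW.trans (f.preimage_mono hV))
  have e : (W' : ((f ⁻¹ᵁ U : X.Opens) : Scheme.{u}).Opens) ≤
      (f ∣_ U) ⁻¹ᵁ (V' : (U : Scheme.{u}).Opens) := by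
    change (f ⁻¹ᵁ U).ι ⁻¹ᵁ (W : X.Opens) ≤ (f ∣_ U) ⁻¹ᵁ (U.ι ⁻¹ᵁ (V : S.Opens))
    rw [← Scheme.Hom.comp_preimage, morphismRestrict_ι, Scheme.Hom.comp_preimage]
    exact (f ⁻¹ᵁ U).ι.preimage_mono hW
  have h := HasRingHomProperty.appLE P (f := f ∣_ U) hP V' W' e
  rw [morphismRestrict_appLE] at h
  have hV' : U.ι ''ᵁ (V' : (U : Scheme.{u}).Opens) = V :=
    congrArg Subtype.val (Limits.imageAffineOpens_preimageAffineOpens U V hV)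
  have hW' : (f ⁻¹ᵁ U).ι ''ᵁ (W' : ((f ⁻¹ᵁ U : X.Opens) : Scheme.{u}).Opens) = W :=
    congrArg Subtype.val (Limits.imageAffineOpens_preimageAffineOpens (f ⁻¹ᵁ U) W
      (hW.trans (f.preimage_mono hV)))
  exact (Scheme.Hom.appLE_congr f _ hV' hW' (fun g => Q g.hom)).mp h

/-- **`P` local on the target holds over `W` if it holds over the members of an open cover of
`W`.** [folklore] -/
theorem morphismRestrict_of_le_iSup (P : MorphismProperty Scheme.{u}) [IsZariskiLocalAtTarget P]
    {X Y : Scheme.{u}} (f : X ⟶ Y) {ι : Type*} (V : ι → Y.Opens) (W : Y.Opens)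
    (hVW : ∀ i, V i ≤ W) (hcov : W ≤ ⨆ i, V i) (h : ∀ i, P (f ∣_ V i)) : P (f ∣_ W) := by
  refine IsZariskiLocalAtTarget.of_iSup_eq_top (fun i => W.ι ⁻¹ᵁ V i) ?_ fun i => ?_
  · refine top_le_iff.mp fun x _ => ?_
    have hx : x.1 ∈ ⨆ i, V i := hcov x.2
    rw [Opens.mem_iSup] at hx
    obtain ⟨i, hi⟩ := hx
    exact Opens.mem_iSup.mpr ⟨i, show W.ι x ∈ V i by rwa [Scheme.Opens.ι_apply]⟩
  · have himg : W.ι ''ᵁ (W.ι ⁻¹ᵁ V i) = V i := by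
      rw [Scheme.Hom.image_preimage_eq_opensRange_inf, Scheme.Opens.opensRange_ι,
        inf_eq_right.mpr (hVW i)]
    rw [P.arrow_mk_iso_iff (morphismRestrictRestrict f W (W.ι ⁻¹ᵁ V i)),
      P.arrow_mk_iso_iff (morphismRestrictEq f himg)]
    exact h i

/-- **A closed immersion of affine schemes whose kernel is `b`-power torsion is an isomorphism
over `D(b)`**: if `j : X → X'` is a closed immersion of affine schemes and every global section
of `X'` killed by `j` is killed by a power of `b ∈ Γ(X', 𝒪_{X'})`, then `j` restricts to an
isomorphism `j⁻¹D(b) ≅ D(b)` (`Γ(X', D(b)) = Γ(X', 𝒪)[1/b] → Γ(X, D(j♯b)) = Γ(X, 𝒪)[1/j♯b]` is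
injective, and a closed immersion with zero kernel is an isomorphism). [folklore] -/
theorem isIso_morphismRestrict_basicOpen_of_ker_torsion {X X' : Scheme.{u}} [IsAffine X]
    [IsAffine X'] (j : X ⟶ X') [IsClosedImmersion j] (b : Γ(X', ⊤))
    (htor : ∀ y : Γ(X', ⊤), j.appTop y = 0 → ∃ m : ℕ, b ^ m * y = 0) :
    IsIso (j ∣_ X'.basicOpen b) := by
  -- injectivity of `Γ(X', D(b)) → Γ(X, j⁻¹D(b))`
  have hinj : Function.Injective (j.app (X'.basicOpen b)) := by
    rw [injective_iff_map_eq_zero]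
    intro z hz
    obtain ⟨⟨x, ⟨_, n, rfl⟩⟩, hx⟩ := IsLocalization.surj (Submonoid.powers b) z
    dsimp only at hx
    have hu : IsUnit (algebraMap Γ(X', ⊤) Γ(X', X'.basicOpen b) b) :=
      IsLocalization.Away.algebraMap_isUnit b
    -- naturality of `j` on elements
    have hnat : ∀ y : Γ(X', ⊤), j.app (X'.basicOpen b) (algebraMap Γ(X', ⊤) Γ(X', X'.basicOpen b) y) =
        X.presheaf.map ((Opens.map j.base).map (homOfLE (X'.basicOpen_le b))).op (j.appTop y) := by
      intro y
      have h := congrArg (fun k => k y) (j.naturality (homOfLE (X'.basicOpen_le b)).op)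
      simp only [CommRingCat.comp_apply] at h
      exact h
    -- `j` kills the numerator `x` over `j⁻¹D(b)` …
    have h1 : X.presheaf.map ((Opens.map j.base).map (homOfLE (X'.basicOpen_le b))).op (j.appTop x) = 0 := by
      rw [← hnat, ← hx, map_mul, hz, zero_mul]
    -- … hence in `Γ(X, D(j♯b)) = Γ(X, 𝒪_X)[1/j♯b]`
    have hVeq : j ⁻¹ᵁ X'.basicOpen b = X.basicOpen (j.appTop b) := Scheme.preimage_basicOpen_top j b
    have h1' : X.presheaf.map (homOfLE (le_top : j ⁻¹ᵁ X'.basicOpen b ≤ ⊤)).op (j.appTop x) = 0 :=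
      h1
    have h3 : algebraMap Γ(X, ⊤) Γ(X, X.basicOpen (j.appTop b)) (j.appTop x) = 0 := by
      have hfac : X.presheaf.map (homOfLE (X.basicOpen_le (j.appTop b))).op =
          X.presheaf.map (homOfLE (le_top : j ⁻¹ᵁ X'.basicOpen b ≤ ⊤)).op ≫
            X.presheaf.map (homOfLE hVeq.ge).op := by
        rw [← X.presheaf.map_comp]
        rfl
      have h := congrArg (fun k => k (j.appTop x)) hfac
      simp only [CommRingCat.comp_apply, h1', map_zero] at h
      exact h
    obtain ⟨⟨_, m, rfl⟩, hm⟩ := (IsLocalization.map_eq_zero_iff (Submonoid.powers (j.appTop b))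
      Γ(X, X.basicOpen (j.appTop b)) (j.appTop x)).mp h3
    dsimp only at hm
    obtain ⟨k, hk⟩ := htor (b ^ m * x) (by rw [map_mul, map_pow]; exact hm)
    -- so `x` vanishes in `Γ(X', D(b))`, and so does `z`
    have hx0 : algebraMap Γ(X', ⊤) Γ(X', X'.basicOpen b) x = 0 := by
      have h := congrArg (algebraMap Γ(X', ⊤) Γ(X', X'.basicOpen b)) hk
      rw [map_mul, map_mul, map_pow, map_pow, map_zero, ← mul_assoc, ← pow_add] at h
      exact (hu.pow _).mul_right_eq_zero.mp h
    have hz0 : z * algebraMap Γ(X', ⊤) Γ(X', X'.basicOpen b) (b ^ n) = 0 := by rw [hx, hx0]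
    rw [map_pow] at hz0
    exact (hu.pow n).mul_left_eq_zero.mp hz0
  -- a closed immersion with zero kernel is an isomorphism
  haveI : IsClosedImmersion (j ∣_ X'.basicOpen b) := IsZariskiLocalAtTarget.restrict ‹_› _
  refine IsClosedImmersion.isIso_iff_ker_eq_bot.mpr ?_
  haveI : IsAffine (X'.basicOpen b : Scheme.{u}) := (isAffineOpen_top X').basicOpen b
  refine Scheme.IdealSheafData.ext_of_isAffine ?_
  rw [Scheme.ker_morphismRestrict_ideal, Scheme.Hom.ker_apply]
  simp only [Scheme.IdealSheafData.ideal_bot, Pi.bot_apply]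
  have key : ∀ O : X'.Opens, O = X'.basicOpen b → Function.Injective (j.app O) := by
    rintro _ rfl
    exact hinj
  exact (RingHom.injective_iff_ker_eq_bot _).mp (key _ (Scheme.Opens.ι_image_top _))

end Helpers

/-! ## The affine case -/

set_option maxHeartbeats 800000 in
/-- **Stacks 081R for a finite morphism over an affine base.** Let `S` be affine, `f : X → S`
finite and `U ⊆ S` a quasi-compact open with `X_U → U` flat and locally of finite presentation.
Then there are an ideal sheaf `𝓘` of finite type on `S` with support disjoint from `U` and a
blowing up `b : S' → S` in `𝓘` such that the strict transform of `X` along `b` is flat and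
locally of finite presentation. Proof (Stacks, Tag 0810, ¶1, for the finite `S`-scheme `X`):
`U = ⋃ D(gᵢ)`; `X = Spec B` with `B` finite over `R = Γ(S, 𝒪_S)` and `B[1/gᵢ]` finitely presented
over `R[1/gᵢ]`; `B` is a quotient of a finite finitely presented `R`-algebra `B'` with kernel
killed by powers of the `gᵢ`, so `X → X' = Spec B'` is a closed immersion of `S`-schemes which is
an isomorphism over `U`; flatten the strict transform of `X'` by a blowing up with centre
supported on exactly `S ∖ U` (`exists_isBlowup_support_eq_flat_lfp_of_isFinite`) and conclude by
`blowupStrictTransformMap_comp_iff_of_isClosedImmersion`.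
[cite: StacksProject, Tag 081R with Tag 0810 (proof, ¶1); RaynaudGruson1971, Première partie Thm. 5.2.2] -/
theorem exists_isBlowup_flat_lfp_of_isFinite_of_isAffine {X S : Scheme.{u}} (f : X ⟶ S)
    [IsAffine S] [IsFinite f] (U : S.Opens) (hU : IsCompact (U : Set S)) (hflat : Flat (f ∣_ U))
    (hlfp : LocallyOfFinitePresentation (f ∣_ U)) :
    ∃ (I : S.IdealSheafData) (S' : Scheme.{u}) (b : S' ⟶ S),
      (∀ W : S.affineOpens, (I.ideal W).FG) ∧ Disjoint (U : Set S) (I.support : Set S) ∧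
      IsBlowup b I ∧ Flat (blowupStrictTransformMap f b I) ∧
      LocallyOfFinitePresentation (blowupStrictTransformMap f b I) := by
  classical
  haveI : IsAffine X := isAffine_of_isAffineHom f
  /- Step 1: `U = ⋃ᵢ D(gᵢ)` -/
  obtain ⟨s, hs, hUs⟩ :=
    isCompact_and_isOpen_iff_finite_and_eq_biUnion_basicOpen.mp ⟨hU, U.2⟩
  haveI : Finite s := hs.to_subtype
  let g : s → Γ(S, ⊤) := Subtype.val
  have hDU : ∀ i : s, S.basicOpen (g i) ≤ U := fun i x hx => by
    change x ∈ (U : Set S)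
    rw [hUs]
    exact Set.mem_biUnion i.2 hx
  have hUcov : U ≤ ⨆ i : s, S.basicOpen (g i) := fun x hx => by
    have hx' : x ∈ (U : Set S) := hx
    rw [hUs] at hx'
    obtain ⟨r, hr, hxr⟩ := Set.mem_iUnion₂.mp hx'
    exact Opens.mem_iSup.mpr ⟨⟨r, hr⟩, hxr⟩
  /- Step 2: the finite ring map `φ : R → B` and its finitely presented localisations -/
  let φ : Γ(S, ⊤) →+* Γ(X, ⊤) := f.appTop.hom
  have hφfin : φ.Finite :=
    ((HasAffineProperty.iff_of_isAffine (P := @IsFinite) (f := f)).mp inferInstance).2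
  have hle : ∀ i : s, X.basicOpen (φ (g i)) ≤ f ⁻¹ᵁ S.basicOpen (g i) := fun i =>
    (Scheme.preimage_basicOpen_top f (g i)).ge
  let φg : ∀ i : s, Γ(S, S.basicOpen (g i)) →+* Γ(X, X.basicOpen (φ (g i))) := fun i =>
    (f.appLE (S.basicOpen (g i)) (X.basicOpen (φ (g i))) (hle i)).hom
  have hcomp : ∀ i : s, (φg i).comp (algebraMap Γ(S, ⊤) Γ(S, S.basicOpen (g i))) =
      (algebraMap Γ(X, ⊤) Γ(X, X.basicOpen (φ (g i)))).comp φ := fun i => by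
    have key : S.presheaf.map (homOfLE (S.basicOpen_le (g i))).op ≫
        f.appLE (S.basicOpen (g i)) (X.basicOpen (φ (g i))) (hle i) =
        f.appTop ≫ X.presheaf.map (homOfLE ((hle i).trans (f.preimage_mono le_top))).op := by
      rw [Scheme.Hom.map_appLE]
      rfl
    exact congrArg CommRingCat.Hom.hom key
  have hfp : ∀ i : s, (φg i).FinitePresentation := fun i =>
    appLE_of_morphismRestrict @LocallyOfFinitePresentation f U hlfp
      ⟨S.basicOpen (g i), (isAffineOpen_top S).basicOpen _⟩ (hDU i)
      ⟨X.basicOpen (φ (g i)), (isAffineOpen_top X).basicOpen _⟩ (hle i)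
  /- Step 3: the finite finitely presented hull `B'` -/
  obtain ⟨B', instB', ρ, π, hρfin, hρfp, hπsurj, hπρ, htor⟩ :=
    Literature.RingTheory.Localization.exists_finite_finitePresentation_surjective φ hφfin g
      (fun i => Γ(S, S.basicOpen (g i))) (fun i => Γ(X, X.basicOpen (φ (g i))))
      (fun i => inferInstance) (fun i => isLocalization_away_of_isAffine (φ (g i))) φg hcomp hfp
  letI := instB'
  /- Step 4: `X ↪ X' = Spec B'` over `S` -/
  let ρ' : Γ(S, ⊤) ⟶ CommRingCat.of B' := CommRingCat.ofHom ρ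
  let π' : CommRingCat.of B' ⟶ Γ(X, ⊤) := CommRingCat.ofHom π
  have hρπ : ρ' ≫ π' = f.appTop := CommRingCat.hom_ext (by
    change π.comp ρ = f.appTop.hom
    exact hπρ)
  let X' : Scheme.{u} := Spec (CommRingCat.of B')
  let f' : X' ⟶ S := Spec.map ρ' ≫ S.isoSpec.inv
  let j : X ⟶ X' := X.isoSpec.hom ≫ Spec.map π'
  have hf : j ≫ f' = f := by
    simp only [j, f', Category.assoc]
    rw [← Spec.map_comp_assoc, hρπ, Scheme.isoSpec_hom_naturality_assoc, Iso.hom_inv_id,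
      Category.comp_id]
  haveI : IsClosedImmersion (Spec.map π') := IsClosedImmersion.spec_of_surjective _ hπsurj
  haveI : IsClosedImmersion j := inferInstance
  haveI : IsFinite (Spec.map ρ') := (IsFinite.SpecMap_iff _).mpr hρfin
  haveI : IsFinite f' := inferInstance
  haveI : LocallyOfFinitePresentation (Spec.map ρ') :=
    (HasRingHomProperty.Spec_iff (P := @LocallyOfFinitePresentation)).mpr hρfp
  haveI : LocallyOfFinitePresentation f' := inferInstance
  /- Step 5: `j` is an isomorphism over `f'⁻¹U = ⋃ᵢ D(f'♯gᵢ)` -/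
  -- `j♯ = π ∘ (Γ(Spec B') ≅ B')` and `(Γ(Spec B') ≅ B') (f'♯ gᵢ) = ρ gᵢ`
  have hjt : ∀ y : Γ(X', ⊤), j.appTop y = π ((Scheme.ΓSpecIso (.of B')).hom y) := fun y => by
    have hn : (Scheme.ΓSpecIso Γ(X, ⊤)).hom ((Spec.map π').appTop y) =
        π' ((Scheme.ΓSpecIso (.of B')).hom y) :=
      congrArg (fun k => k y) (Scheme.ΓSpecIso_naturality π')
    have hj : j.appTop = (Spec.map π').appTop ≫ (Scheme.ΓSpecIso Γ(X, ⊤)).hom := by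
      rw [← Scheme.toSpecΓ_appTop]
      exact Scheme.Hom.comp_appTop _ _
    rw [hj]
    exact hn
  have hft : ∀ i : s, (Scheme.ΓSpecIso (.of B')).hom (f'.appTop (g i)) = ρ (g i) := fun i => by
    have hid : S.isoSpec.inv.appTop ≫ (Scheme.ΓSpecIso Γ(S, ⊤)).hom = 𝟙 _ := by
      rw [← Scheme.toSpecΓ_appTop]
      change S.isoSpec.inv.appTop ≫ S.isoSpec.hom.appTop = 𝟙 _
      rw [← Scheme.Hom.comp_appTop, Iso.hom_inv_id, Scheme.Hom.id_appTop]
    have hmor : f'.appTop ≫ (Scheme.ΓSpecIso (.of B')).hom = ρ' := by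
      change (Spec.map ρ' ≫ S.isoSpec.inv).appTop ≫ _ = ρ'
      rw [Scheme.Hom.comp_appTop, Category.assoc, Scheme.ΓSpecIso_naturality ρ', ← Category.assoc,
        hid, Category.id_comp]
    exact congrArg (fun k => k (g i)) hmor
  have htor' : ∀ (i : s) (y : Γ(X', ⊤)), j.appTop y = 0 →
      ∃ m : ℕ, f'.appTop (g i) ^ m * y = 0 := by
    intro i y hy
    rw [hjt] at hy
    obtain ⟨m, hm⟩ := htor i ((Scheme.ΓSpecIso (.of B')).hom y) (by rwa [RingHom.mem_ker])
    refine ⟨m, (Scheme.ΓSpecIso (.of B')).commRingCatIsoToRingEquiv.injective ?_⟩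
    rw [map_mul, map_pow, map_zero]
    change (Scheme.ΓSpecIso (.of B')).hom (f'.appTop (g i)) ^ m * (Scheme.ΓSpecIso (.of B')).hom y = 0
    rw [hft]
    exact hm
  have hV : ∀ i : s, IsIso (j ∣_ X'.basicOpen (f'.appTop (g i))) := fun i =>
    isIso_morphismRestrict_basicOpen_of_ker_torsion j _ (htor' i)
  have hVle : ∀ i : s, X'.basicOpen (f'.appTop (g i)) ≤ f' ⁻¹ᵁ U := fun i =>
    (Scheme.preimage_basicOpen_top f' (g i)).ge.trans (f'.preimage_mono (hDU i))
  have hVcov : f' ⁻¹ᵁ U ≤ ⨆ i : s, X'.basicOpen (f'.appTop (g i)) := fun x hx => by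
    have hx' : f' x ∈ (U : Set S) := hx
    rw [hUs] at hx'
    obtain ⟨r, hr, hxr⟩ := Set.mem_iUnion₂.mp hx'
    refine Opens.mem_iSup.mpr ⟨⟨r, hr⟩, ?_⟩
    change x ∈ X'.basicOpen (f'.appTop r)
    rw [← Scheme.preimage_basicOpen_top]
    exact hxr
  haveI hjU : IsIso (j ∣_ f' ⁻¹ᵁ U) :=
    (MorphismProperty.isomorphisms.iff _).mp (morphismRestrict_of_le_iSup
      (MorphismProperty.isomorphisms Scheme.{u}) j _ (f' ⁻¹ᵁ U) hVle hVcov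
      fun i => (MorphismProperty.isomorphisms.iff _).mpr (hV i))
  /- Step 6: `f'` is flat over `U` -/
  have hflat' : Flat (f' ∣_ U) := by
    have h := hflat
    rw [← hf, morphismRestrict_comp] at h
    exact (MorphismProperty.cancel_left_of_respectsIso @Flat (j ∣_ f' ⁻¹ᵁ U) (f' ∣_ U)).mp h
  /- Step 7: flatten the strict transform of `X'`, with centre supported on exactly `S ∖ U` -/
  haveI := hflat'
  obtain ⟨I, S', b, hIfg, hIsupp, hb, hflatI, hlfpI⟩ :=
    exists_isBlowup_support_eq_flat_lfp_of_isFinite f' U hU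
  have hCU : centreCompl I = U := centreCompl_eq_of_support_eq hIsupp
  haveI : IsIso (j ∣_ f' ⁻¹ᵁ centreCompl I) := by
    rw [hCU]
    exact hjU
  refine ⟨I, S', b, hIfg, by rw [hIsupp]; exact disjoint_compl_right, hb, ?_, ?_⟩
  · have h := (blowupStrictTransformMap_comp_iff_of_isClosedImmersion j f' b I @Flat
      hb.isEffectiveCartier).mpr hflatI
    rwa [hf] at h
  · have h := (blowupStrictTransformMap_comp_iff_of_isClosedImmersion j f' b I
      @LocallyOfFinitePresentation hb.isEffectiveCartier).mpr hlfpI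
    rwa [hf] at h

/-! ## The general case -/

/-- **Stacks 081R (Raynaud–Gruson 5.2.2) for finite morphisms.** Let `S` be quasi-compact and
quasi-separated, `f : X → S` finite and `U ⊆ S` a quasi-compact open with `X_U → U` flat and
locally of finite presentation. Then there are an ideal sheaf `𝓘` of finite type on `S` with
support disjoint from `U` and a blowing up `b : S' → S` of `S` in `𝓘` — a `U`-admissible blowing
up — such that the strict transform of `X` along `b` is flat and locally of finite presentation
over `S'`: the affine-base case glued by `exists_isBlowup_flat_lfp_of_forall_affineOpens_base`.
(This is the conclusion of the named fact `Stacks081R` for `f` finite; the fact itself has `f`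
merely of finite type and quasi-separated.)
[cite: StacksProject, Tag 081R; RaynaudGruson1971, Première partie Thm. 5.2.2] -/
theorem exists_isBlowup_flat_lfp_of_isFinite {X S : Scheme.{u}} (f : X ⟶ S) [CompactSpace S]
    [QuasiSeparatedSpace S] [IsFinite f] (U : S.Opens) (hU : IsCompact (U : Set S))
    (hflat : Flat (f ∣_ U)) (hlfp : LocallyOfFinitePresentation (f ∣_ U)) :
    ∃ (I : S.IdealSheafData) (S' : Scheme.{u}) (b : S' ⟶ S),
      (∀ W : S.affineOpens, (I.ideal W).FG) ∧ Disjoint (U : Set S) (I.support : Set S) ∧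
      IsBlowup b I ∧ Flat (blowupStrictTransformMap f b I) ∧
      LocallyOfFinitePresentation (blowupStrictTransformMap f b I) := by
  refine exists_isBlowup_flat_lfp_of_forall_affineOpens_base f U hU fun T => ?_
  haveI : IsAffine (T : Scheme.{u}) := T.2
  haveI : QuasiCompact (T : S.Opens).ι := quasiCompact_ι_of_isCompact _ T.2.isCompact
  exact exists_isBlowup_flat_lfp_of_isFinite_of_isAffine (pullback.snd f (T : S.Opens).ι)
    ((T : S.Opens).ι ⁻¹ᵁ U) ((T : S.Opens).ι.isCompact_preimage hU)
    (pullback_snd_morphismRestrict_preimage @Flat f _ U hflat)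
    (pullback_snd_morphismRestrict_preimage @LocallyOfFinitePresentation f _ U hlfp)

/-- The same in the binder shape of the named fact `Stacks081R` (`StrictTransformFlattening.lean`),
for `f` finite. [cite: StacksProject, Tag 081R; RaynaudGruson1971, Première partie Thm. 5.2.2] -/
theorem stacks081R_isFinite ⦃X S : Scheme.{u}⦄ (f : X ⟶ S) [CompactSpace S] [QuasiSeparatedSpace S]
    [IsFinite f] (U : S.Opens) (hU : IsCompact (U : Set S)) (hflat : Flat (f ∣_ U))
    (hlfp : LocallyOfFinitePresentation (f ∣_ U)) :
    ∃ (I : S.IdealSheafData) (S' : Scheme.{u}) (b : S' ⟶ S),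
      (∀ W : S.affineOpens, (I.ideal W).FG) ∧ Disjoint (U : Set S) (I.support : Set S) ∧
      IsBlowup b I ∧ Flat (blowupStrictTransformMap f b I) ∧
      LocallyOfFinitePresentation (blowupStrictTransformMap f b I) :=
  exists_isBlowup_flat_lfp_of_isFinite f U hU hflat hlfp

end Literature.AlgebraicGeometry.Resolution

end
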